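import Literature.NumberTheory.EllipticCurves.DeuringFrobeniusLiftProofs
import Literature.NumberTheory.EllipticCurves.CMAnalyticDegreeProofs
import Literature.NumberTheory.EllipticCurves.ComplexMultiplicationJInvariantProofs
import Literature.NumberTheory.EllipticCurves.ComplexMultiplicationHasCMProofs
import Literature.NumberTheory.EllipticCurves.GeomEndRingTransport
import Literature.NumberTheory.EllipticCurves.GlobalMinimalModelProofs
import Literature.NumberTheory.QuadraticFields.ClassNumberOnePrincipalPrimes
import HarnessLib

/-!
# A curve over `ℚ` with complex multiplication has CM by an order of class number one
# (by reduction modulo split primes — no class field theory)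

Topic `NumberTheory/EllipticCurves`; a proofs-only file (theorems only, no definitions, no named
facts).  For an elliptic curve `E/ℚ` with (geometric) complex multiplication, the full ring of
multipliers `𝒪 = End(Λ) = {x ∈ ℂ : xΛ ⊆ Λ}` of a period lattice `Λ` of `E/ℂ` is an imaginary
quadratic order of discriminant `D`, and `j(E) = j(τ_Q)` for a primitive positive definite form
`Q` of discriminant `D` (Cox, *Primes of the form x² + ny²*, Thm. 10.14; Silverman, *AEC*,
Thm. VI.5.5; the tree's `exists_isPrimitive_j_eq_of_hasCM`).  **We prove `h(D) = 1`**
(`exists_form_classNumber_eq_one_of_hasCM`) — i.e. Silverman, *AEC*, App. C §11,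
Example 11.3.2: *"if `j(E) ∈ ℚ`, then `𝒞(ℤ + f𝓡) = {1}`"* — **without the First Main Theorem of
complex multiplication** (the tree's named fact `irreducible_classPolynomial`, Cox Prop. 13.2),
by Deuring's reduction theory instead:

1. every good prime `p ∤ 2 D Δ` which splits in `ℚ(√D)` is the norm of an element of `𝒪`
   (`DeuringFrobeniusLiftProofs`: an element `ρ = u + vφ ∈ End_{ℚ̄}(E)` reduces to `m·Frob_p`
   with `p ∤ m`, kills `E[m]` and has `#ker ρ = m²p`; analytically, `α_ρ/m ∈ 𝒪` has norm
   `#ker ρ / m² = p`, by the analytic representation and degree formula of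
   `CMAnalyticRepresentation` / `CMAnalyticDegreeProofs`, Cox §14.B);
2. `𝒪 = ℤ + ℤ·aτ_Q` (Cox, Lemma 7.5), whose norm form is `(1, −b, ac) ~ ` the principal form of
   discriminant `D`, so the principal form represents every such `p`;
3. hence `h(D) = 1` (`QuadraticFields/ClassNumberOnePrincipalPrimes.lean`, Cox Thm. 7.7 with
   Lemmas 2.3, 2.25 in the language of forms).

Status in the tree.  The same conclusion — a rational singular modulus has class number one —
is also proved in `ComplexMultiplicationHasCMTwoLeavesProofs.lean`
(`classNumber_eq_one_of_formJ_eq_ratCast`) by a different route (conjugacy of the singular moduli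
through the modular equation and Kronecker's congruence, `SingularModuliConjugate.lean`), and the
classification `WeierstrassCurve.hasCM_iff_j_mem` is assembled from it and the class number one
theorem alone in `ComplexMultiplicationHasCMIffProofs.lean`
(`hasCM_iff_j_mem_of_mem_classNumberOneDiscrs`, `hasCM_iff_j_mem_of_heegnerStarkOddDiscr`).  The
present file is an independent second proof by Deuring reduction (Lang, *Elliptic Functions*,
Ch. 13 §4), which in addition identifies the good split primes as norms from the full multiplier
ring; nothing is re-assembled here.

## References

* J. H. Silverman, *The Arithmetic of Elliptic Curves*, 2nd ed., GTM 106 (2009): App. C §11,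
  Examples 11.3.1–11.3.2; Thm. VI.5.3, VI.5.5. [SilvermanAEC2009]
* D. A. Cox, *Primes of the form x² + ny²*, 2nd ed. (2013): Lemma 7.5, Thm. 7.7, Thm. 7.30,
  Thm. 10.14, §14.B–C (Thm. 14.16). [Cox2013]
* S. Lang, *Elliptic Functions*, 2nd ed., GTM 112 (1987): Ch. 13 §4 Thms. 12–13. [Lang1987]
* M. Deuring, *Die Typen der Multiplikatorenringe elliptischer Funktionenkörper*, Abh. Math. Sem.
  Univ. Hamburg 14 (1941), 197–272. [Deuring1941]

## Design

`noncomputable section`, `open scoped Classical`; nothing is defined.  The analytic side works, as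
in `CMAnalyticRepresentation`, with a short model `E/ℚ` whose base change to `ℂ` *is* `L.curve`;
the reduction side (`DeuringFrobeniusLiftProofs`) with a globally minimal model `C • E`
(`hasGlobalMinimalModel_rat_holds`); the two geometric endomorphism rings are identified by
conjugation with the substitution isomorphism (`exists_ringEquiv_geomEndRing_of_addEquiv`,
`isAlgebraicOn_pointEquiv_trans_congrEquiv`).
-/

noncomputable section

open scoped Classical ComplexConjugate UpperHalfPlane

namespace Literature.NumberTheory.EllipticCurves

open _root_.WeierstrassCurve _root_.PeriodPair _root_.Complex
open Literature.NumberTheory.QuadraticFields.BinaryQuadraticForm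

/-! ### Lattice lemmas: the multiplier ring of `Λ_τ` (Cox, Lemma 7.5) and its norm form -/

/-- `ℝ`-independence of `1, τ` for `τ ∈ ℍ`, integer form: `Aτ + B = 0` with `A, B ∈ ℤ` forces
`A = B = 0`. [folklore] -/
theorem int_mul_coe_add_int_eq_zero {τ : ℍ} {A B : ℤ} (h : (A : ℂ) * (τ : ℂ) + B = 0) :
    A = 0 ∧ B = 0 := by
  have him := congrArg Complex.im h
  simp only [add_im, mul_im, intCast_re, intCast_im, zero_mul, add_zero, zero_im,
    UpperHalfPlane.coe_im] at him
  have hA : A = 0 := by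
    rcases mul_eq_zero.1 him with h0 | h0
    · exact_mod_cast h0
    · exact absurd h0 τ.im_pos.ne'
  subst hA
  simp only [Int.cast_zero, zero_mul, zero_add, Int.cast_eq_zero] at h
  exact ⟨rfl, h⟩

/-- **The multiplier ring of `Λ_τ` is `ℤ + ℤ·aτ`** (Cox, *Primes of the form x² + ny²*, Lemma 7.5:
for `τ` a root of the primitive form `ax² + bxy + cy²`, `{β : βΛ_τ ⊆ Λ_τ} = [1, aτ]`): if
`x·Λ_τ ⊆ Λ_τ` then `x = u + v·aτ` with integers `u, v`.  (`x = mτ + n` and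
`xτ = mτ² + nτ ∈ Λ_τ` give `a ∣ mb`, `a ∣ mc`, hence `a ∣ m` as `gcd(a, b, c) = 1`.)
[cite: Cox2013, §7.A Lemma 7.5] -/
theorem exists_int_eq_add_mul_of_mul_mem_lattice {τ : ℍ} {Q : ℤ × ℤ × ℤ} (hQ1 : 0 < Q.1)
    (hprim : IsPrimitive Q) (hQ : (Q.1 : ℂ) * (τ : ℂ) ^ 2 + Q.2.1 * τ + Q.2.2 = 0) {x : ℂ}
    (hx : ∀ l ∈ (PeriodPair.ofUpperHalfPlane τ).lattice,
      x * l ∈ (PeriodPair.ofUpperHalfPlane τ).lattice) :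
    ∃ u v : ℤ, x = u + v * ((Q.1 : ℂ) * (τ : ℂ)) := by
  obtain ⟨a, b, c⟩ := Q
  simp only at hQ1 hQ ⊢
  have h1 : (1 : ℂ) ∈ (PeriodPair.ofUpperHalfPlane τ).lattice := by
    simpa using (PeriodPair.ofUpperHalfPlane τ).ω₂_mem_lattice
  have hτ : (τ : ℂ) ∈ (PeriodPair.ofUpperHalfPlane τ).lattice := by
    simpa using (PeriodPair.ofUpperHalfPlane τ).ω₁_mem_lattice
  obtain ⟨m, n, hmn⟩ := PeriodPair.mem_lattice.1 (hx 1 h1)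
  obtain ⟨m', n', hmn'⟩ := PeriodPair.mem_lattice.1 (hx _ hτ)
  simp only [PeriodPair.ofUpperHalfPlane_ω₁, PeriodPair.ofUpperHalfPlane_ω₂, mul_one] at hmn hmn'
  -- `x = mτ + n`, `xτ = m'τ + n'`; multiply by `a` and use `aτ² = -bτ - c`
  have key : ((a * n - m * b - a * m' : ℤ) : ℂ) * (τ : ℂ) + ((-(m * c) - a * n' : ℤ) : ℂ) = 0 := by
    push_cast
    have e1 : x * τ = m' * τ + n' := hmn'.symm
    rw [← hmn] at e1
    linear_combination (a : ℂ) * e1 - (m : ℂ) * hQ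
  obtain ⟨k1, k2⟩ := int_mul_coe_add_int_eq_zero key
  -- `a ∣ m b` and `a ∣ m c`, hence `a ∣ m` by primitivity
  have hab : a ∣ m * b := ⟨n - m', by linarith⟩
  have hac : a ∣ m * c := ⟨-n', by linarith⟩
  have ham : a ∣ m := by
    have hg : Int.gcd (Int.gcd a b) c = 1 := hprim
    have h2 : (Int.gcd a b : ℤ) = a * Int.gcdA a b + b * Int.gcdB a b := Int.gcd_eq_gcd_ab a b
    have h3 : ((Int.gcd (Int.gcd a b) c : ℕ) : ℤ) =
        (Int.gcd a b : ℤ) * Int.gcdA (Int.gcd a b) c + c * Int.gcdB (Int.gcd a b) c :=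
      Int.gcd_eq_gcd_ab _ _
    rw [hg, Nat.cast_one] at h3
    -- `a ∣ m · gcd(a, b)`
    have hmg : a ∣ m * (Int.gcd a b : ℤ) := by
      rw [h2, mul_add]
      refine dvd_add (Dvd.intro (m * Int.gcdA a b) (by ring)) ?_
      rw [← mul_assoc]
      exact hab.mul_right _
    have hm : m = m * (Int.gcd a b : ℤ) * Int.gcdA (Int.gcd a b) c +
        m * c * Int.gcdB (Int.gcd a b) c := by
      linear_combination m * h3
    rw [hm]
    exact dvd_add (hmg.mul_right _) (hac.mul_right _)
  obtain ⟨v, rfl⟩ := ham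
  refine ⟨n, v, ?_⟩
  rw [← hmn]
  push_cast
  ring

/-- **Real and imaginary parts of a CM point**: if `τ ∈ ℍ` and `aτ² + bτ + c = 0` then
`2a·Re τ = −b` and `a²(Im τ)² = ac − b²/4`, i.e. `4a²(Im τ)² = 4ac − b²`. [folklore] -/
theorem re_im_of_quadratic {τ : ℍ} {a b c : ℤ}
    (h : (a : ℂ) * (τ : ℂ) ^ 2 + b * τ + c = 0) :
    2 * a * (τ : ℂ).re = -b ∧ 4 * a ^ 2 * (τ : ℂ).im ^ 2 = 4 * a * c - (b : ℝ) ^ 2 := by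
  set x := (τ : ℂ).re with hx
  set y := (τ : ℂ).im with hy
  have hy0 : 0 < y := τ.im_pos
  have hre := congrArg Complex.re h
  have him := congrArg Complex.im h
  simp only [add_re, mul_re, intCast_re, intCast_im, zero_mul, sub_zero, zero_re, add_im, mul_im,
    add_zero, zero_im, sq] at hre him
  rw [← hx, ← hy] at hre him
  have him' : y * (2 * a * x + b) = 0 := by linear_combination him
  have hxB : 2 * a * x + b = 0 := by
    rcases mul_eq_zero.1 him' with h0 | h0
    · exact absurd h0 hy0.ne'
    · exact h0
  refine ⟨by linarith, ?_⟩
  have key : (a : ℝ) * y * y = a * x * x + b * x + c := by linear_combination -hre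
  linear_combination 4 * (a : ℝ) * key + (2 * a * x + b) * hxB

/-- **The norm form of `ℤ + ℤ·aτ` is `(1, −b, ac)`**: for `τ` a root of `ax² + bx + c` in `ℍ`
and integers `u, v`, `|u + v·aτ|² = u² − buv + acv²` (Cox, (7.1)/(7.6): the norm form of the order
`[1, aτ]` of discriminant `b² − 4ac`). [cite: Cox2013, §7.A Lemma 7.5 and eq. (7.6)] -/
theorem normSq_int_add_int_mul {τ : ℍ} {a b c : ℤ}
    (h : (a : ℂ) * (τ : ℂ) ^ 2 + b * τ + c = 0) (u v : ℤ) :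
    ((u : ℂ) + v * ((a : ℂ) * (τ : ℂ))) * conj ((u : ℂ) + v * ((a : ℂ) * (τ : ℂ))) =
      ((u ^ 2 - b * u * v + a * c * v ^ 2 : ℤ) : ℂ) := by
  obtain ⟨hre, him⟩ := re_im_of_quadratic h
  rw [Complex.mul_conj]
  apply Complex.ext
  · simp only [Complex.ofReal_re, intCast_re]
    rw [Complex.normSq_apply]
    simp only [add_re, intCast_re, mul_re, intCast_im, zero_mul, sub_zero, add_im, mul_im,
      add_zero, zero_add]
    push_cast
    linear_combination ((u : ℝ) * v + (v : ℝ) ^ 2 * (2 * a * (τ : ℂ).re - b) / 4) * hre +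
      ((v : ℝ) ^ 2 / 4) * him
  · simp only [Complex.ofReal_im, intCast_im]

/-- **From `(1, −b, ac)` to the principal form**: if `p = u² − buv + ev²` and `b² − 4e = D` then the
principal form of discriminant `D` (`(1, 0, −D/4)` or `(1, 1, (1 − D)/4)`) represents `p` — the two
forms differ by the translation `T^{(σ+b)/2}`. [folklore] -/
theorem principalForm_repr_of_repr {D b e p u v : ℤ} (h : p = u ^ 2 - b * u * v + e * v ^ 2)
    (hdisc : b ^ 2 - 4 * e = D) :
    ∃ u' v' : ℤ, p = (principalForm D).1 * u' ^ 2 + (principalForm D).2.1 * u' * v' +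
      (principalForm D).2.2 * v' ^ 2 := by
  unfold principalForm
  rcases Int.even_or_odd b with ⟨β, hβ⟩ | ⟨β, hβ⟩
  · -- `b = 2β`, `D = 4(β² - e) ≡ 0 (mod 4)`
    have hD : D = 4 * (β ^ 2 - e) := by rw [← hdisc, hβ]; ring
    have h4 : D % 4 = 0 := by rw [hD]; exact Int.mul_emod_right _ _
    rw [if_pos h4]
    refine ⟨u - β * v, v, ?_⟩
    have hq : -D / 4 = e - β ^ 2 := by
      rw [hD, show -(4 * (β ^ 2 - e)) = 4 * (e - β ^ 2) by ring,
        Int.mul_ediv_cancel_left _ (by norm_num)]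
    simp only [hq, h, hβ]
    ring
  · -- `b = 2β + 1`, `D = 4(β² + β - e) + 1 ≡ 1 (mod 4)`
    have hD : D = 4 * (β ^ 2 + β - e) + 1 := by rw [← hdisc, hβ]; ring
    have h4 : ¬ D % 4 = 0 := by rw [hD]; omega
    rw [if_neg h4]
    refine ⟨u - (β + 1) * v, v, ?_⟩
    have hq : (1 - D) / 4 = e - β ^ 2 - β := by
      rw [hD, show 1 - (4 * (β ^ 2 + β - e) + 1) = 4 * (e - β ^ 2 - β) by ring,
        Int.mul_ediv_cancel_left _ (by norm_num)]
    simp only [hq, h, hβ]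
    ring

/-! ### The main theorem: CM over `ℚ` forces class number one -/

/-- **An elliptic curve over `ℚ` with complex multiplication has CM by an order of class number
one** (Silverman, *AEC*, App. C §11, Example 11.3.2: *"if `j(E) ∈ ℚ`, then `𝒞(ℤ + f𝓡) = {1}`"*),
proved by Deuring reduction in place of the First Main Theorem.  For a short Weierstrass curve
`E/ℚ` with `E ⊗ ℂ = E_Λ` and (geometric) CM: the lattice `Λ` is homothetic to `Λ_{τ_Q}` for a
primitive positive definite form `Q = (a, b, c)` (Cox, Thm. 10.14 / *AEC* VI.5.5), `j(Λ) = j(τ_Q)`,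
and **`h(b² − 4ac) = 1`**.  Proof: the multiplier ring of `Λ` is `𝒪 = ℤ + ℤ·aτ_Q` (Cox, Lemma 7.5),
with norm form `(1, −b, ac)`; for every prime `p ∤ 2dΔ` (`d = disc ℤ[φ]` for the chosen CM
endomorphism `φ`, `Δ` the minimal discriminant) at which `D` is a non-zero square,
`DeuringFrobeniusLiftProofs` (on a global minimal model, `hasGlobalMinimalModel_rat_holds`,
transported by `exists_ringEquiv_geomEndRing_of_addEquiv`) yields `ρ = u + vφ` killing `E[m]`,
`p ∤ m`, with `#ker ρ = m²p`; then `x = α_ρ/m ∈ 𝒪` (`apply_eq_zero_iff_analyticRepr_mul_mem`) has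
`x x̄ = #ker ρ/m² = p` (`natCard_ker_eq_analyticRepr_mul_conj`), so the principal form represents `p`;
conclude by `classNumber_eq_one_of_forall_prime_repr`.
[cite: SilvermanAEC2009, App. C §11, Example 11.3.2] -/
theorem exists_form_classNumber_eq_one_of_hasCM (E : WeierstrassCurve ℚ) [E.IsElliptic]
    (L : PeriodPair) (hE : E.baseChange ℂ = L.curve) (hCM : E.HasCM) :
    ∃ Q : ℤ × ℤ × ℤ, 0 < Q.1 ∧ IsPrimitive Q ∧ discr Q < 0 ∧ L.j = formJ Q ∧
      classNumber (discr Q) = 1 := by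
  -- an embedding `σ : ℚ̄ → ℂ` and the analytic representation
  set σ : AlgebraicClosure ℚ →ₐ[ℚ] ℂ :=
    (@IsAlgClosed.lift ℂ _ _ ℚ _ _ (AlgebraicClosure ℚ) _ _ (AlgebraicClosure.instAlgebra ℚ) _ _ _
      (AlgebraicClosure.isAlgebraic ℚ)) with hσ
  obtain ⟨φ, hφ, hn⟩ := hCM
  set xφ : E.geomEndRing := ⟨φ, hφ⟩ with hxφ
  set αφ : ℂ := analyticRepr hE σ xφ with hαφ
  have hinjR := analyticReprHom_injective hE σ
  have hαΛ : ∀ l ∈ L.lattice, αφ * l ∈ L.lattice := fun l hl ↦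
    analyticRepr_mul_mem_lattice hE σ xφ hl
  have hαint : ∀ k : ℤ, αφ ≠ k := by
    intro k hk
    apply hn k
    have h1 : analyticReprHom hE σ xφ = analyticReprHom hE σ (k : E.geomEndRing) := by
      rw [analyticReprHom_apply, analyticReprHom_apply, analyticRepr_intCast, ← hαφ, hk]
    have h2 := hinjR h1
    have h3 := congrArg (fun z : E.geomEndRing ↦ (z : AddMonoid.End E.geomPoints)) h2
    simpa [hxφ] using h3
  -- `Λ = c₀ · Λ_τ`
  obtain ⟨τ, c₀, hc₀, hLτ⟩ := L.exists_lattice_eq_mulLeft_ofUpperHalfPlane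
  have htransfer : ∀ y : ℂ, (∀ l ∈ L.lattice, y * l ∈ L.lattice) →
      ∀ l ∈ (PeriodPair.ofUpperHalfPlane τ).lattice,
        y * l ∈ (PeriodPair.ofUpperHalfPlane τ).lattice := by
    intro y hy l hl
    have h1 : c₀ * l ∈ L.lattice := by rw [hLτ]; exact PeriodPair.mul_mem_mulLeft_lattice.2 hl
    have h2 := hy _ h1
    rw [hLτ, PeriodPair.mem_mulLeft_lattice] at h2
    rwa [show c₀⁻¹ * (y * (c₀ * l)) = y * l by field_simp] at h2
  have hατ := htransfer αφ hαΛ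
  -- `τ = τ_Q` for a primitive positive definite form `Q = (a, b, c)`
  have hτCM : (PeriodPair.ofUpperHalfPlane τ).HasCM := ⟨αφ, hαint, hατ⟩
  obtain ⟨A, B, C, hA, hABC⟩ := exists_quadratic_of_hasCM_ofUpperHalfPlane hτCM
  obtain ⟨Q, hQ1, hprim, hQ⟩ := exists_isPrimitive_of_quadratic hA hABC
  obtain ⟨hdisc, hτQ⟩ := discr_neg_and_heegnerTau_eq (A := Q.1) (B := Q.2.1) (C := Q.2.2) hQ1 hQ
  have hD4 : discr Q % 4 = 0 ∨ discr Q % 4 = 1 := discr_emod_four Q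
  refine ⟨Q, hQ1, hprim, hdisc, ?_, ?_⟩
  · rw [formJ_def, hτQ, PeriodPair.j_eq_of_lattice_eq hLτ, PeriodPair.j_mulLeft]
  -- notation
  obtain ⟨a, b, c⟩ := Q
  simp only at hQ1 hQ hdisc hD4 ⊢
  rw [discr_apply] at hdisc ⊢
  rw [discr_apply] at hD4
  set D : ℤ := b ^ 2 - 4 * a * c with hDdef
  -- `αφ = u₀ + v₀ aτ`, `v₀ ≠ 0`
  obtain ⟨u₀, v₀, hα⟩ := exists_int_eq_add_mul_of_mul_mem_lattice hQ1 hprim hQ hατ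
  have hv₀ : v₀ ≠ 0 := by
    rintro rfl
    exact hαint u₀ (by rw [hα]; push_cast; ring)
  -- Cox normal form: `ω = φ - u₀ + s`, `ω² - dω + c' = 0`, `d = v₀² D`, `4c' = d(d-1)`
  set d : ℤ := v₀ ^ 2 * D with hd
  have hd0 : d < 0 :=
    mul_neg_of_pos_of_neg (lt_of_le_of_ne (sq_nonneg v₀) (Ne.symm (pow_ne_zero 2 hv₀))) hdisc
  obtain ⟨s, hs⟩ : ∃ s : ℤ, 2 * s = d + v₀ * b := by
    refine ⟨(d + v₀ * b) / 2, Int.mul_ediv_cancel' ?_⟩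
    have : d + v₀ * b = (v₀ * b) * (v₀ * b + 1) - 4 * (v₀ ^ 2 * a * c) := by rw [hd, hDdef]; ring
    rw [this]
    exact dvd_sub (Int.even_mul_succ_self _).two_dvd (dvd_mul_of_dvd_left (by norm_num) _)
  set c' : ℤ := s ^ 2 - v₀ * b * s + v₀ ^ 2 * a * c with hc'
  have hdc : d * (d - 1) = 4 * c' := by
    linear_combination (-4) * hc' + (v₀ * b - 2 * s - d) * hs - hd - v₀ ^ 2 * hDdef
  set xω : E.geomEndRing := xφ - (u₀ : E.geomEndRing) + (s : E.geomEndRing) with hxω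
  have hαω : analyticRepr hE σ xω = v₀ * ((a : ℂ) * (τ : ℂ)) + s := by
    have : analyticReprHom hE σ xω = analyticReprHom hE σ xφ - u₀ + s := by
      rw [hxω, map_add, map_sub, map_intCast, map_intCast]
    rw [analyticReprHom_apply, analyticReprHom_apply, ← hαφ, hα] at this
    rw [this]; push_cast; ring
  have hrel : xω * xω - (d : E.geomEndRing) * xω + (c' : E.geomEndRing) = 0 := by
    apply hinjR
    rw [map_zero, map_add, map_sub, map_mul, map_mul, map_intCast, map_intCast,
      analyticReprHom_apply, hαω]
    have hd' : (d : ℂ) = 2 * s - v₀ * b := by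
      have : (d : ℤ) = 2 * s - v₀ * b := by linarith
      exact_mod_cast this
    have hc'' : (c' : ℂ) = s ^ 2 - v₀ * b * s + v₀ ^ 2 * a * c := by
      rw [hc']; push_cast; ring
    rw [hd', hc'']
    linear_combination ((v₀ : ℂ) ^ 2 * a) * hQ
  -- a global minimal model `W = C • E` and the transport `e : End(W) ≃ End(E)`
  obtain ⟨C, hC⟩ := hasGlobalMinimalModel_rat_holds E
  haveI : (C • E).IsGloballyMinimal := hC
  set W : WeierstrassCurve ℚ := C • E with hW
  set Cb : VariableChange (AlgebraicClosure ℚ) := C.map (algebraMap ℚ (AlgebraicClosure ℚ))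
    with hCb
  have hCbW : Cb • E.baseChange (AlgebraicClosure ℚ) = W.baseChange (AlgebraicClosure ℚ) := by
    rw [hCb, hW, WeierstrassCurve.baseChange, WeierstrassCurve.baseChange,
      WeierstrassCurve.map_variableChange]
  set ι : E.geomPoints ≃+ W.geomPoints :=
    (VariableChange.pointEquiv (E.baseChange (AlgebraicClosure ℚ)) Cb).trans
      (Affine.Point.congrEquiv hCbW) with hι
  obtain ⟨e, he⟩ := exists_ringEquiv_geomEndRing_of_addEquiv ι
    (isAlgebraicOn_pointEquiv_trans_congrEquiv Cb hCbW)
    (isAlgebraicOn_pointEquiv_trans_congrEquiv_symm Cb hCbW)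
  set xω' : W.geomEndRing := e.symm xω with hxω'
  have hrel' : xω' * xω' - (d : W.geomEndRing) * xω' + (c' : W.geomEndRing) = 0 := by
    have := congrArg e.symm hrel
    simpa [hxω'] using this
  -- the modulus `M = 2 d Δ_W`
  set M : ℤ := 2 * d * WeierstrassCurve.minimalDiscriminantInt W with hM
  have hM0 : M ≠ 0 := mul_ne_zero (mul_ne_zero two_ne_zero hd0.ne)
    (WeierstrassCurve.minimalDiscriminantInt_ne_zero W)
  refine classNumber_eq_one_of_forall_prime_repr hdisc hD4 hM0 fun p hp hpM hpD ⟨B₀, hB₀⟩ ↦ ?_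
  -- a prime `p ∤ M`, `p ∤ D`, `D ≡ B₀² (mod p)`
  haveI : Fact p.Prime := ⟨hp⟩
  have hpZ : Prime (p : ℤ) := Nat.prime_iff_prime_int.mp hp
  have hp2 : p ≠ 2 := by
    rintro rfl
    exact hpM (by
      rw [hM]
      exact Dvd.intro (d * WeierstrassCurve.minimalDiscriminantInt W) (by push_cast; ring))
  have hpd : ¬ (p : ℤ) ∣ d := fun h ↦ hpM (by rw [hM]; exact (h.mul_left 2).mul_right _)
  have hΔ : ¬ (p : ℤ) ∣ WeierstrassCurve.minimalDiscriminantInt W := fun h ↦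
    hpM (by rw [hM]; exact h.mul_left _)
  have hsq : IsSquare ((d : ℤ) : ZMod p) := by
    refine ⟨((v₀ * B₀ : ℤ) : ZMod p), ?_⟩
    have h1 : ((B₀ ^ 2 - D : ℤ) : ZMod p) = 0 := by
      rw [ZMod.intCast_zmod_eq_zero_iff_dvd]; exact hB₀
    push_cast at h1 ⊢
    rw [show (d : ZMod p) = (v₀ : ZMod p) ^ 2 * D by rw [hd]; push_cast; ring]
    linear_combination -((v₀ : ZMod p) ^ 2) * h1
  -- Deuring: `ρ' = u + v ω'` kills `W[m]`, `#ker ρ' = m² p`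
  obtain ⟨m, u, v, hm, hpm, hkill, hker⟩ :=
    exists_cmEnd_apply_torsion_eq_zero_natCard_ker W xω' hd0 hdc hrel' p hp2 hΔ hpd hsq
  -- transport back to `E`: `ρ = e ρ' = u + v ω`
  set xρ' : W.geomEndRing := (u : W.geomEndRing) + (v : W.geomEndRing) * xω' with hxρ'
  set xρ : E.geomEndRing := (u : E.geomEndRing) + (v : E.geomEndRing) * xω with hxρ
  have heρ : e xρ' = xρ := by
    rw [hxρ', map_add, map_mul, map_intCast, map_intCast, hxω', RingEquiv.apply_symm_apply]
  have hkillE : ∀ P : E.geomPoints, m • P = 0 → (xρ : AddMonoid.End E.geomPoints) P = 0 := by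
    intro P hP
    rw [← heρ, he xρ' P]
    have hιP : m • ι P = 0 := by rw [← map_nsmul, hP, map_zero]
    rw [hkill (ι P) hιP, map_zero]
  have hkerE : Nat.card (AddMonoidHom.ker ((xρ : AddMonoid.End E.geomPoints) :
      E.geomPoints →+ E.geomPoints)) = m ^ 2 * p := by
    rw [← hker, ← heρ]
    refine Nat.card_congr (ι.toEquiv.subtypeEquiv fun P ↦ ?_)
    change (e xρ' : AddMonoid.End E.geomPoints) P = 0 ↔ (xρ' : AddMonoid.End W.geomPoints) (ι P) = 0
    rw [he xρ' P, ι.symm.map_eq_zero_iff]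
  -- analytic: `α_ρ ᾱ_ρ = m² p`, `x = α_ρ / m ∈ 𝒪`, `x x̄ = p`
  have hαρ : analyticRepr hE σ xρ = u + v * (v₀ * ((a : ℂ) * (τ : ℂ)) + s) := by
    have : analyticReprHom hE σ xρ = u + v * analyticReprHom hE σ xω := by
      rw [hxρ, map_add, map_mul, map_intCast, map_intCast]
    rw [analyticReprHom_apply, analyticReprHom_apply, hαω] at this
    exact this
  have hρ0 : xρ ≠ 0 := by
    intro h0
    have h1 : Nat.card (AddMonoidHom.ker ((xρ : AddMonoid.End E.geomPoints) :
        E.geomPoints →+ E.geomPoints)) = 0 := by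
      rw [h0]
      change Nat.card (AddMonoidHom.ker (0 : E.geomPoints →+ E.geomPoints)) = 0
      rw [AddMonoidHom.ker_zero, AddSubgroup.card_top]
      exact Nat.card_eq_zero_of_infinite
    rw [hkerE] at h1
    exact mul_ne_zero (pow_ne_zero 2 hm.ne') hp.ne_zero h1
  have hαρ0 : analyticRepr hE σ xρ ≠ 0 := by
    intro h0
    apply hρ0
    apply hinjR
    rw [analyticReprHom_apply, h0, map_zero]
  have hnorm : analyticRepr hE σ xρ * conj (analyticRepr hE σ xρ) = (m : ℂ) ^ 2 * p := by
    rw [← natCard_ker_eq_analyticRepr_mul_conj hE σ xρ hαρ0, hkerE]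
    push_cast; ring
  -- `x = αρ / m` multiplies `Λ` into itself
  have hm0 : (m : ℂ) ≠ 0 := by exact_mod_cast hm.ne'
  have hxΛ : ∀ l ∈ L.lattice, analyticRepr hE σ xρ / m * l ∈ L.lattice := by
    intro l hl
    obtain ⟨P, hP⟩ := exists_latticePointEmb_eq_toPoint_div hE σ hm hl
    have hPm : m • P = 0 := by
      apply latticePointEmb_injective hE σ
      rw [map_nsmul, hP, map_zero, ← toPointHom_apply (toPoint_add_holds (L := L)), ← map_nsmul,
        toPointHom_apply, nsmul_eq_mul, mul_div_cancel₀ _ hm0]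
      exact toPoint_of_mem hl
    have h1 := (apply_eq_zero_iff_analyticRepr_mul_mem hE σ xρ hP).1 (hkillE P hPm)
    rwa [show analyticRepr hE σ xρ * (l / m) = analyticRepr hE σ xρ / m * l by
      field_simp] at h1
  obtain ⟨u', v', hx'⟩ :=
    exists_int_eq_add_mul_of_mul_mem_lattice hQ1 hprim hQ (htransfer _ hxΛ)
  have hxx : (analyticRepr hE σ xρ / m) * conj (analyticRepr hE σ xρ / m) = p := by
    rw [map_div₀, map_natCast, div_mul_div_comm, hnorm]
    field_simp
  have hrepr : ((u' ^ 2 - b * u' * v' + a * c * v' ^ 2 : ℤ) : ℂ) = ((p : ℤ) : ℂ) := by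
    rw [← normSq_int_add_int_mul hQ u' v', ← hx', hxx]
    push_cast; rfl
  have hreprZ : (p : ℤ) = u' ^ 2 - b * u' * v' + (a * c) * v' ^ 2 := by
    have : u' ^ 2 - b * u' * v' + a * c * v' ^ 2 = (p : ℤ) := by exact_mod_cast hrepr
    linarith
  exact principalForm_repr_of_repr hreprZ (by rw [hDdef]; ring)


/-! ### For an arbitrary model -/

/-- **CM over `ℚ` forces class number one — any model.**  For an elliptic curve `W/ℚ` with
(geometric) complex multiplication there is a primitive positive definite form `Q = (a, b, c)` with
`j(W) = j(τ_Q)` and `h(b² − 4ac) = 1` (Silverman, *AEC*, App. C §11, Example 11.3.2, by Deuring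
reduction: `exists_form_classNumber_eq_one_of_hasCM` applied to the short model
`(0, 0, 0, −c₄/48, −c₆/864)` of `W`, whose base change to `ℂ` is the curve `E_Λ` of a period lattice
`Λ` of `W/ℂ` — the tree's `exists_isNeronLatticeOf_holds` and `PeriodPair.j_eq_weierstrassCurve_j`).
[cite: SilvermanAEC2009, App. C §11, Example 11.3.2] -/
theorem exists_form_j_eq_classNumber_eq_one_of_hasCM (W : WeierstrassCurve ℚ) [W.IsElliptic]
    (hCM : W.HasCM) :
    ∃ Q : ℤ × ℤ × ℤ, 0 < Q.1 ∧ IsPrimitive Q ∧ discr Q < 0 ∧ (W.j : ℂ) = formJ Q ∧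
      classNumber (discr Q) = 1 := by
  haveI : (W.baseChange ℂ).IsElliptic := by rw [WeierstrassCurve.baseChange]; infer_instance
  obtain ⟨L, hL⟩ :=
    Literature.NumberTheory.EllipticCurves.ModularForms.exists_isNeronLatticeOf_holds (W.baseChange ℂ)
  -- the short model `E₀` of `W`, with `E₀ ⊗ ℂ = E_Λ`
  set E₀ : WeierstrassCurve ℚ := ⟨0, 0, 0, -W.c₄ / 48, -W.c₆ / 864⟩ with hE₀def
  have hg₂ : L.g₂ = (W.c₄ : ℂ) / 12 := by
    rw [hL.1]; simp [WeierstrassCurve.baseChange, WeierstrassCurve.map_c₄]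
  have hg₃ : L.g₃ = (W.c₆ : ℂ) / 216 := by
    rw [hL.2]; simp [WeierstrassCurve.baseChange, WeierstrassCurve.map_c₆]
  have hE₀ : E₀.baseChange ℂ = L.curve := by
    rw [PeriodPair.curve, hg₂, hg₃]
    ext
    · simp [hE₀def, WeierstrassCurve.baseChange]
    · simp [hE₀def, WeierstrassCurve.baseChange]
    · simp [hE₀def, WeierstrassCurve.baseChange]
    · simp only [hE₀def, WeierstrassCurve.baseChange, WeierstrassCurve.map_a₄, eq_ratCast]
      push_cast
      ring
    · simp only [hE₀def, WeierstrassCurve.baseChange, WeierstrassCurve.map_a₆, eq_ratCast]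
      push_cast
      ring
  have hc₄ : E₀.c₄ = W.c₄ := by
    simp only [hE₀def, WeierstrassCurve.c₄, WeierstrassCurve.b₂, WeierstrassCurve.b₄]; ring
  have hc₆ : E₀.c₆ = W.c₆ := by
    simp only [hE₀def, WeierstrassCurve.c₆, WeierstrassCurve.b₂, WeierstrassCurve.b₄,
      WeierstrassCurve.b₆]; ring
  have hΔ : E₀.Δ = W.Δ := by
    have h1 := E₀.c_relation
    have h2 := W.c_relation
    rw [hc₄, hc₆, ← h2] at h1
    exact mul_left_cancel₀ (by norm_num) h1
  haveI hE₀ell : E₀.IsElliptic := by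
    rw [WeierstrassCurve.isElliptic_iff, hΔ]; exact W.isUnit_Δ
  have hj : E₀.j = W.j := by
    rw [WeierstrassCurve.j, WeierstrassCurve.j, Units.val_inv_eq_inv_val,
      Units.val_inv_eq_inv_val, WeierstrassCurve.coe_Δ', WeierstrassCurve.coe_Δ', hΔ, hc₄]
  have hCM₀ : E₀.HasCM := (hasCM_iff_of_j_eq hj).2 hCM
  obtain ⟨Q, hQ1, hprim, hdisc, hjQ, h1⟩ := exists_form_classNumber_eq_one_of_hasCM E₀ L hE₀ hCM₀
  have hjV : (W.baseChange ℂ).j = (W.j : ℂ) := by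
    simp only [WeierstrassCurve.baseChange, WeierstrassCurve.map_j, eq_ratCast]
  have hjW : L.j = (W.j : ℂ) := (PeriodPair.j_eq_weierstrassCurve_j hL.1 hL.2).trans hjV
  exact ⟨Q, hQ1, hprim, hdisc, hjW ▸ hjQ, h1⟩

end Literature.NumberTheory.EllipticCurves

end
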